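/-
Copyright (c) 2026 the pub-hodgecm-mathlib formalisation cell (harness21).  Prover seat hodgecm-mathlib-K2E1-p12 (g4) (free E1 analytic hand spilled to S8 per LEAD #21),
Track B ∕ K2-LIT, h413 = `stmt-HodgeConjecture-24833`, R90-TF section S8 «ContSpec-n½», deal S8-R60 (2026-09-04T22:39:51Z): the N = 3 TWIN of ★ p862453
`R90S8ResHIsotypicVectorsAreResiduesU2` ON MOK'S CARRIER `quasiSplit L⁺ L c 3` (G-SIDE SEAM RULE S8-R51) — letter (N_blk,₃) `hN` of ★ F1_qs p862541
`residualG_le_topologicalClosure_of_letters_quasiSplit`, keyed to ★ G-DEFS `R90S8ResGBlockDataU3Defs` (K2E1-p11 (g3)): `resGBlock ∕ resGAtom ∕ resGLine`.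
-/
import Summits.HodgeConjecture.HodgeConjecture.Theorems.R90S8ResHIsotypicVectorsAreResiduesU2   -- ★ p862453 (R90-C133-p02): §1 `subrep_le_orthogonal_of_lineModel_cm` — EVERY `N`, every `H` (★ D5′ `lpModel_blockProj_eq_zero_of_irreducible_subrep_cm`, ★ `residualSubspace`, ★ Mok's `quasiSplit`)
import Summits.HodgeConjecture.HodgeConjecture.Theorems.R90S8ResGBlockDataU3Defs             -- ★ G-DEFS (K2E1-p11 (g3)): `resGBlock K' ω χ₁ χ₂` ∕ `resGAtom U …` (three-slot model `U : L² →ₗ[ℂ] (A × M) × Λ`) ∕ `resGLine U …`, `inner_eq_zero_of_mem_resGLine`, `resGLine_le_resGBlock`, `isClosed_resGBlock`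
import HarnessLib

/-!
# S8 #2 road (G side), letter (N_blk,₃) — `R90S8ResGIsotypicVectorsAreResiduesU3`: the isotypic vectors of an irreducible closed subrepresentation of `L²(U(J₃)_{L∕L⁺})`
# are ORTHOGONAL TO THE LINE SPACE of every Borel block `Sc(K′, ω; χ₁, χ₂)`, from ★ D5′, modulo D5′'s model letters and the line-space interface (N = 3 twin of ★ p862453)

Track B ∕ K2-LIT, crux h413 = `stmt-HodgeConjecture-24833`, route of record `HCCMUnconditional`; cell `hodgecm-mathlib`, R90-TF programme, section S8 «ContSpec-n½», socket #2
`sock_S8_res_classification` of `Lines/R90_S8_ResidualSpectrumU3B.lean` (B ED. 4 :205–:214; chain F1_qs ⟹ F2 ⟹ #2, ★ p862541's module docstring).  THEOREMS ONLY (no `def`, no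
`instance`, no `notation`, no named-fact hypothesis, no `sorry`; default heartbeats); lane `--supports stmt-HodgeConjecture-24833 --as helper` (count-neutral).  CLOSES NO SOCKET and pays no
socket: it supplies the (N_blk,₃) binder `hN` of ★ F1_qs `residualG_le_topologicalClosure_of_letters_quasiSplit` (tree `R90S8ResGLeClosureOfLettersU3.lean` :150–151) at an ARBITRARY level
datum `(K′, ω)` (letter shape rule S8-R29 (2)), for ANY line space `Ln` satisfying the interface (N-iface) below (§2) — and BY NAME at the line space of record `Ln := resGLine L μ U′ K′ ω χ₁ χ₂`
of ★ G-DEFS (§3), exactly as ★ p862453 does on the H side (`N = 2`).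

THE LETTER (bytes :150–151 of ★ F1_qs).  `hN : ∀ i b W′, W′.IsTopIrreducible → W′ ≤ residualSubspace (quasiSplit L⁺ L c 3) μ 𝔓 → W′.toSubmodule ⊓ Iso(K′ i, ω i) ≤ (Ln i b)ᗮ` with
`Iso(K′, ω) = ⨅ k : K′, eigenspace (R k) (ω k)`: an irreducible of `L²_res(U(2,1))` has NO LINE MASS in any Borel block ([MW95 IV.3.12 (b), V.3.13, VI.2]; [Rogawski1990 §13.9 p. 229]:
`L²_res` is spanned by RESIDUES of Eisenstein series, the unitary-axis wave packets are continuous spectrum).  As on the H side the residual and isotypic hypotheses are idle: the content is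
«lines ⟂ every irreducible».

THE MATHEMATICS = ★ D5′ (E1 5Res ENDGAME; ★ p860349 abstract, ★ p860487 at `U(H)(𝔸_{L⁺})`, EVERY `N`), assembled once and for all in ★ p862453 §1 `subrep_le_orthogonal_of_lineModel_cm`
(every `N`, every `H`, any unitary strongly continuous `π`): on the block `V_P = {P v = v}` of the block projector `P = P_χ ∘L R_f(e)` the arch-central Hecke operators act through the line
coordinate `U` of the block model by symbols `s_j`; on an irreducible `W` they act by scalars, the joint level sets are Lebesgue-null on the unitary axis (`hline`), so `U (P w) = 0` for
`w ∈ W`; a line space `Ln ≤ V_P` DETECTED by the line coordinate ((N-iface): `v ∈ Ln`, `P y = y`, `U y = 0` ⟹ `⟪v, y⟫ = 0`) is then orthogonal to `W` (`P` self-adjoint).  THIS FILE only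
instantiates: `(quasiSplit L⁺ L c 3).Adelic = (cmDatum L 3 ((antidiagonal 3).over L)).Adelic` definitionally (★ `quasiSplit_eq_cmDatum`), `π := R` on `L²(μ)`.
* §2 **`resG_isotypic_le_orthogonal_of_lineModel`** — THE (N_blk,₃) CLAUSE at Mok's `U(J₃)`, arbitrary `𝔓`, `(K′, ω)`, `Ln`: the bytes of `hN i b` with `K′ i ↦ K′`, `ω i ↦ ω`, `Ln i b ↦ Ln`.
* §3 **`resG_isotypic_le_orthogonal_lines`** — THE (N_blk,₃) CLAUSE BY NAME at `Ln := resGLine L μ U′ K′ ω χ₁ χ₂` (★ G-DEFS D3: `resGBlock` = the closed `(K′,ω; χ₁,χ₂)`-block `Sc`,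
  `resGAtom U′ = Sc ⊓ ker (snd ∘ U′)`, `resGLine U′ = Sc ⊓ (resGAtom U′)ᗮ`, for a THREE-SLOT block-model coordinate `U′ : L² →ₗ[ℂ] (A × M) × L²(Ω; E)` — top atoms × middle atoms × line, D2),
  `U := snd ∘ U′`; (N-iface) discharged by ★ `inner_eq_zero_of_mem_resGLine` ∕ `resGLine_le_resGBlock` ∕ `isClosed_resGBlock`, leaving the two visible model letters
  `hScP : resGBlock ≤ V_P` (the block's generators are `(K′,ω)`-isotypic) and `hUker : resGBlockᗮ ≤ ker U′` («`U′` factors through the block projection», by construction of the model).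
VISIBLE LETTERS (the honest bill, = D5′'s D-road bill at this block, IDENTICAL to the H side): the block-projector data `(κ, μK, χ; e, K′_f)` with `hPdef`, (L1) `T, hT𝓐, hTP, hTB`, (L2) the
model `U ∕ U′, s, hs, hU`, (L3) `hline`; (N-iface) `hLnP, hLnU` (§2) resp. `hScP, hUker` (§3).  Nothing else; no statement of ★ F1_qs is restated.
HONEST LABEL: HC_CM is proved only modulo the 7 printed citations (2 remaining named inputs: hLiu418 = `stmt-HodgeConjecture-24832`, h413 = `stmt-HodgeConjecture-24833`) until
rung 0 closes; REL ≠ ★ ≠ BUILT; this file asserts no named fact, is conditional by construction on its visible binders, and closes no socket; count-neutral.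

## References
* [MoeglinWaldspurger1995] C. Mœglin, J.-L. Waldspurger, *Spectral Decomposition and Eisenstein Series* (1995), I.2.18, IV.3.12 (b), V.3.13, VI.2.
* [Rogawski1990] J. D. Rogawski, *Automorphic Representations of Unitary Groups in Three Variables* (1990), §13.9 p. 229.
* [DeitmarEchterhoff2014] A. Deitmar, S. Echterhoff, *Principles of Harmonic Analysis* (2014), Lemma 6.1.7, Prop. 6.2.1.
* [ReedSimonI1980] M. Reed, B. Simon, *Methods of Modern Mathematical Physics I* (1980), Thm. II.3, Thm. VII.2.
-/

set_option autoImplicit false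
set_option linter.dupNamespace false  -- the mandated namespace `…HodgeConjecture.HodgeConjecture.R90.S8` (LEAD #1 L1) repeats the summit's segment

noncomputable section

open MeasureTheory Filter Topology CompactlySupported NumberField ContRepresentation Set
open scoped InnerProductSpace ENNReal ComplexConjugate
open Literature.NumberTheory.Automorphic Literature.NumberTheory.Automorphic.UnitaryGroup Literature.NumberTheory.GaloisRepresentations AdelicGroupData
open Literature.NumberTheory.Automorphic.Arthur2013.Leaves.TECR
open Summit.HodgeConjecture.HodgeConjecture.Cruxes.H413.K2E1CuspidalSpectrumUnitary (residualSubspace)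
open Summit.HodgeConjecture.HodgeConjecture.Cruxes.H413.K2E1HeckeAlgebraLettersCM

namespace Summit.HodgeConjecture.HodgeConjecture.R90.S8

/-! ## §2 The (N_blk,₃) clause of ★ F1_qs at Mok's `U(J₃) = quasiSplit L⁺ L c 3`, arbitrary level datum `(K′, ω)` and line space `Ln` -/

section Print

variable (L : Type) [Field L] [NumberField L] [IsCMField L]
  (μ : Measure (quasiSplit (↥(maximalRealSubfield L)) L (IsCMField.complexConj L) 3).automorphicQuotient)
  [(quasiSplit (↥(maximalRealSubfield L)) L (IsCMField.complexConj L) 3).IsAutomorphicMeasure μ]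
  {K : Type*} [Group K] [TopologicalSpace K] [MeasurableSpace K] [BorelSpace K]
  [MeasurableSpace (UnitaryGroup.arch (↥(maximalRealSubfield L)) L (IsCMField.complexConj L) 3 ((StdForm.antidiagonal 3).over L))] [BorelSpace (UnitaryGroup.arch (↥(maximalRealSubfield L)) L (IsCMField.complexConj L) 3 ((StdForm.antidiagonal 3).over L))]
  [MeasurableSpace (finAdelic (↥(maximalRealSubfield L)) L (IsCMField.complexConj L) 3 ((StdForm.antidiagonal 3).over L))] [BorelSpace (finAdelic (↥(maximalRealSubfield L)) L (IsCMField.complexConj L) 3 ((StdForm.antidiagonal 3).over L))]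
  (νinf : Measure (UnitaryGroup.arch (↥(maximalRealSubfield L)) L (IsCMField.complexConj L) 3 ((StdForm.antidiagonal 3).over L))) [IsFiniteMeasureOnCompacts νinf] [νinf.IsMulLeftInvariant] [νinf.IsInvInvariant] [νinf.IsOpenPosMeasure]
  (νf : Measure (finAdelic (↥(maximalRealSubfield L)) L (IsCMField.complexConj L) 3 ((StdForm.antidiagonal 3).over L))) [IsFiniteMeasureOnCompacts νf] [νf.IsMulLeftInvariant] [νf.IsInvInvariant] [νf.IsOpenPosMeasure]
  (κ : K →* UnitaryGroup.arch (↥(maximalRealSubfield L)) L (IsCMField.complexConj L) 3 ((StdForm.antidiagonal 3).over L)) (hκ : Continuous κ)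
  (μK : Measure K) [IsFiniteMeasureOnCompacts μK] [IsProbabilityMeasure μK] [MeasurableMul K] [μK.IsMulLeftInvariant] [MeasurableInv K] [μK.IsInvInvariant]
  (χ : C_c(K, ℂ)) (e : C_c(finAdelic (↥(maximalRealSubfield L)) L (IsCMField.complexConj L) 3 ((StdForm.antidiagonal 3).over L), ℂ))
  {Ω : Type*} {mΩ : MeasurableSpace Ω} (m : Measure Ω) {E : Type*} [NormedAddCommGroup E] [NormedSpace ℂ E] {J : Type*} [Countable J]
variable [ENNReal.HolderTriple ∞ 2 2]

/-- **(N_blk,₃) — THE `hN` CLAUSE OF ★ F1_qs at an arbitrary level datum `(K′, ω)` and an arbitrary line space `Ln`** (letter shape rule S8-R29 (2); N = 3 twin of ★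
`resH_isotypic_le_orthogonal_of_lineModel`): for Mok's `U(J₃) = quasiSplit L⁺ L c 3`, any family of unipotent radicals `𝔓`, any `K′ ≤ U(J₃)(𝔸)` with a character `ω`, given the D5′
data∕letters of a block (`(κ, μK, χ; e, K′_f)`, `hPdef`, (L1)–(L3)) and a line space `Ln` inside `V_P` detected by the line coordinate ((N-iface) `hLnP`, `hLnU`): every topologically
irreducible closed `W′ ≤ L²_res(U(J₃), 𝔓)` has `W′ ∩ Iso(K′, ω) ⟂ Ln` — i.e. the binder `hN i b` of ★ `residualG_le_topologicalClosure_of_letters_quasiSplit` with `K′ i ↦ K′`, `ω i ↦ ω`,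
`Ln i b ↦ Ln` (the residual and isotypic hypotheses are not even needed: ★ §1 gives `W′ ⟂ Ln`). [cite: MoeglinWaldspurger1995, I.2.18, IV.3.12, V.3.13, VI.2] [cite: Rogawski1990, §13.9 p. 229]
[cite: ReedSimonI1980, Thm. II.3] -/
theorem resG_isotypic_le_orthogonal_of_lineModel
    (𝔓 : (quasiSplit (↥(maximalRealSubfield L)) L (IsCMField.complexConj L) 3).ParabolicUnipotentData)
    (K' : Subgroup (quasiSplit (↥(maximalRealSubfield L)) L (IsCMField.complexConj L) 3).Adelic) (ω : ↥K' →* ℂ)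
    (hχmul : ∀ k l, χ (k * l) = χ k * χ l) (hχone : χ 1 = 1) (hχinv : ∀ k, conj (χ k⁻¹) = χ k)
    (K'f : Subgroup (finAdelic (↥(maximalRealSubfield L)) L (IsCMField.complexConj L) 3 ((StdForm.antidiagonal 3).over L))) (he0 : ∀ x, x ∉ K'f → e x = 0) (he1 : ∫ x, e x ∂νf = 1)
    (heK : ∀ k ∈ K'f, ∀ x, e (k * x) = e x) (hestar : ∀ x, mulStar (⇑e) x = e x)
    (P : (quasiSplit (↥(maximalRealSubfield L)) L (IsCMField.complexConj L) 3).L2 μ →L[ℂ] (quasiSplit (↥(maximalRealSubfield L)) L (IsCMField.complexConj L) 3).L2 μ)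
    (hPdef : P = ((((quasiSplit (↥(maximalRealSubfield L)) L (IsCMField.complexConj L) 3).rightRegular μ).restrict ((archToAdelic (↥(maximalRealSubfield L)) L (IsCMField.complexConj L) 3 ((StdForm.antidiagonal 3).over L)).comp κ)).integratedOperator (((quasiSplit (↥(maximalRealSubfield L)) L (IsCMField.complexConj L) 3).isUnitary_rightRegular μ).restrict _)
          (((quasiSplit (↥(maximalRealSubfield L)) L (IsCMField.complexConj L) 3).isStronglyContinuous_rightRegular_holds μ).restrict _ ((continuous_archToAdelic (↥(maximalRealSubfield L)) L (IsCMField.complexConj L) 3 ((StdForm.antidiagonal 3).over L)).comp hκ)) μK χ ∘L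
        (((quasiSplit (↥(maximalRealSubfield L)) L (IsCMField.complexConj L) 3).rightRegular μ).restrict (finAdelicToAdelic (↥(maximalRealSubfield L)) L (IsCMField.complexConj L) 3 ((StdForm.antidiagonal 3).over L))).integratedOperator (((quasiSplit (↥(maximalRealSubfield L)) L (IsCMField.complexConj L) 3).isUnitary_rightRegular μ).restrict _) (((quasiSplit (↥(maximalRealSubfield L)) L (IsCMField.complexConj L) 3).isStronglyContinuous_rightRegular_holds μ).restrict _ (continuous_finAdelicToAdelic (↥(maximalRealSubfield L)) L (IsCMField.complexConj L) 3 ((StdForm.antidiagonal 3).over L))) νf e))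
    (T : J → (quasiSplit (↥(maximalRealSubfield L)) L (IsCMField.complexConj L) 3).L2 μ →L[ℂ] (quasiSplit (↥(maximalRealSubfield L)) L (IsCMField.complexConj L) 3).L2 μ)
    (hT𝓐 : ∀ j, T j ∈ {A' : (quasiSplit (↥(maximalRealSubfield L)) L (IsCMField.complexConj L) 3).L2 μ →L[ℂ] (quasiSplit (↥(maximalRealSubfield L)) L (IsCMField.complexConj L) 3).L2 μ | ∃ (a : C_c(UnitaryGroup.arch (↥(maximalRealSubfield L)) L (IsCMField.complexConj L) 3 ((StdForm.antidiagonal 3).over L), ℂ)) (b : C_c(finAdelic (↥(maximalRealSubfield L)) L (IsCMField.complexConj L) 3 ((StdForm.antidiagonal 3).over L), ℂ)),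
      A' = (((quasiSplit (↥(maximalRealSubfield L)) L (IsCMField.complexConj L) 3).rightRegular μ).restrict (archToAdelic (↥(maximalRealSubfield L)) L (IsCMField.complexConj L) 3 ((StdForm.antidiagonal 3).over L))).integratedOperator (((quasiSplit (↥(maximalRealSubfield L)) L (IsCMField.complexConj L) 3).isUnitary_rightRegular μ).restrict _) (((quasiSplit (↥(maximalRealSubfield L)) L (IsCMField.complexConj L) 3).isStronglyContinuous_rightRegular_holds μ).restrict _ (continuous_archToAdelic (↥(maximalRealSubfield L)) L (IsCMField.complexConj L) 3 ((StdForm.antidiagonal 3).over L))) νinf a ∘L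
          (((quasiSplit (↥(maximalRealSubfield L)) L (IsCMField.complexConj L) 3).rightRegular μ).restrict (finAdelicToAdelic (↥(maximalRealSubfield L)) L (IsCMField.complexConj L) 3 ((StdForm.antidiagonal 3).over L))).integratedOperator (((quasiSplit (↥(maximalRealSubfield L)) L (IsCMField.complexConj L) 3).isUnitary_rightRegular μ).restrict _) (((quasiSplit (↥(maximalRealSubfield L)) L (IsCMField.complexConj L) 3).isStronglyContinuous_rightRegular_holds μ).restrict _ (continuous_finAdelicToAdelic (↥(maximalRealSubfield L)) L (IsCMField.complexConj L) 3 ((StdForm.antidiagonal 3).over L))) νf b})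
    (hTP : ∀ j, Commute P (T j))
    (hTB : ∀ j, ∀ A' ∈ {A' : (quasiSplit (↥(maximalRealSubfield L)) L (IsCMField.complexConj L) 3).L2 μ →L[ℂ] (quasiSplit (↥(maximalRealSubfield L)) L (IsCMField.complexConj L) 3).L2 μ | ∃ (a : C_c(UnitaryGroup.arch (↥(maximalRealSubfield L)) L (IsCMField.complexConj L) 3 ((StdForm.antidiagonal 3).over L), ℂ)) (b : C_c(finAdelic (↥(maximalRealSubfield L)) L (IsCMField.complexConj L) 3 ((StdForm.antidiagonal 3).over L), ℂ)),
      A' = (((quasiSplit (↥(maximalRealSubfield L)) L (IsCMField.complexConj L) 3).rightRegular μ).restrict (archToAdelic (↥(maximalRealSubfield L)) L (IsCMField.complexConj L) 3 ((StdForm.antidiagonal 3).over L))).integratedOperator (((quasiSplit (↥(maximalRealSubfield L)) L (IsCMField.complexConj L) 3).isUnitary_rightRegular μ).restrict _) (((quasiSplit (↥(maximalRealSubfield L)) L (IsCMField.complexConj L) 3).isStronglyContinuous_rightRegular_holds μ).restrict _ (continuous_archToAdelic (↥(maximalRealSubfield L)) L (IsCMField.complexConj L) 3 ((StdForm.antidiagonal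 3).over L))) νinf a ∘L
          (((quasiSplit (↥(maximalRealSubfield L)) L (IsCMField.complexConj L) 3).rightRegular μ).restrict (finAdelicToAdelic (↥(maximalRealSubfield L)) L (IsCMField.complexConj L) 3 ((StdForm.antidiagonal 3).over L))).integratedOperator (((quasiSplit (↥(maximalRealSubfield L)) L (IsCMField.complexConj L) 3).isUnitary_rightRegular μ).restrict _) (((quasiSplit (↥(maximalRealSubfield L)) L (IsCMField.complexConj L) 3).isStronglyContinuous_rightRegular_holds μ).restrict _ (continuous_finAdelicToAdelic (↥(maximalRealSubfield L)) L (IsCMField.complexConj L) 3 ((StdForm.antidiagonal 3).over L))) νf b},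
      ∀ x ∈ LinearMap.eqLocus (P : (quasiSplit (↥(maximalRealSubfield L)) L (IsCMField.complexConj L) 3).L2 μ →ₗ[ℂ] (quasiSplit (↥(maximalRealSubfield L)) L (IsCMField.complexConj L) 3).L2 μ) LinearMap.id, P (A' (T j x)) = T j (P (A' x)))
    (U : (quasiSplit (↥(maximalRealSubfield L)) L (IsCMField.complexConj L) 3).L2 μ →ₗ[ℂ] Lp E 2 m) (s : J → Ω → ℂ) (hs : ∀ j, MemLp (s j) ∞ m)
    (hU : ∀ j, ∀ v ∈ LinearMap.eqLocus (P : (quasiSplit (↥(maximalRealSubfield L)) L (IsCMField.complexConj L) 3).L2 μ →ₗ[ℂ] (quasiSplit (↥(maximalRealSubfield L)) L (IsCMField.complexConj L) 3).L2 μ) LinearMap.id, U (T j v) = (hs j).toLp (s j) • U v)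
    (hline : ∀ c : J → ℂ, m {x | ∀ j, s j x = c j} = 0)
    (Ln : Submodule ℂ ((quasiSplit (↥(maximalRealSubfield L)) L (IsCMField.complexConj L) 3).L2 μ)) (hLnP : ∀ v ∈ Ln, P v = v)
    (hLnU : ∀ v ∈ Ln, ∀ y ∈ LinearMap.eqLocus (P : (quasiSplit (↥(maximalRealSubfield L)) L (IsCMField.complexConj L) 3).L2 μ →ₗ[ℂ] (quasiSplit (↥(maximalRealSubfield L)) L (IsCMField.complexConj L) 3).L2 μ) LinearMap.id, U y = 0 → ⟪v, y⟫_ℂ = 0) :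
    ∀ W' : ClosedSubrep ((quasiSplit (↥(maximalRealSubfield L)) L (IsCMField.complexConj L) 3).rightRegular μ), W'.toContRep.IsTopIrreducible →
      W' ≤ residualSubspace (quasiSplit (↥(maximalRealSubfield L)) L (IsCMField.complexConj L) 3) μ 𝔓 →
        W'.toSubmodule ⊓ (⨅ k : ↥K', Module.End.eigenspace ((((quasiSplit (↥(maximalRealSubfield L)) L (IsCMField.complexConj L) 3).rightRegular μ) (K'.subtype k) : (quasiSplit (↥(maximalRealSubfield L)) L (IsCMField.complexConj L) 3).L2 μ →L[ℂ] (quasiSplit (↥(maximalRealSubfield L)) L (IsCMField.complexConj L) 3).L2 μ) :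
          (quasiSplit (↥(maximalRealSubfield L)) L (IsCMField.complexConj L) 3).L2 μ →ₗ[ℂ] (quasiSplit (↥(maximalRealSubfield L)) L (IsCMField.complexConj L) 3).L2 μ) (ω k)) ≤ Lnᗮ := by
  intro W' hW' _
  -- `(quasiSplit L⁺ L c 3).Adelic = (cmDatum L 3 ((antidiagonal 3).over L)).Adelic` definitionally (★ `adelic_complexConj`): ★ §1 (every `N`) at `π := R`
  exact inf_le_left.trans
    (subrep_le_orthogonal_of_lineModel_cm (H := (StdForm.antidiagonal 3).over L) ((quasiSplit (↥(maximalRealSubfield L)) L (IsCMField.complexConj L) 3).rightRegular μ)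
      ((quasiSplit (↥(maximalRealSubfield L)) L (IsCMField.complexConj L) 3).isUnitary_rightRegular μ)
      ((quasiSplit (↥(maximalRealSubfield L)) L (IsCMField.complexConj L) 3).isStronglyContinuous_rightRegular_holds μ) νinf νf κ hκ μK χ e m hχmul hχone hχinv K'f he0 he1 heK
      hestar P hPdef T hT𝓐 hTP hTB U s hs hU hline Ln hLnP hLnU W' hW')


end Print

/-! ## §3 The (N_blk,₃) clause BY NAME at the line space of record `Ln := R90.S8.resGLine L μ U′ K′ ω χ₁ χ₂` (★ G-DEFS `R90S8ResGBlockDataU3Defs`, three-slot model) -/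

section ByName

open Literature.NumberTheory.GaloisRepresentations

variable (L : Type) [Field L] [NumberField L] [IsCMField L]
  (μ : Measure (quasiSplit (↥(maximalRealSubfield L)) L (IsCMField.complexConj L) 3).automorphicQuotient)
  [(quasiSplit (↥(maximalRealSubfield L)) L (IsCMField.complexConj L) 3).IsAutomorphicMeasure μ]
  {K : Type*} [Group K] [TopologicalSpace K] [MeasurableSpace K] [BorelSpace K]
  [MeasurableSpace (UnitaryGroup.arch (↥(maximalRealSubfield L)) L (IsCMField.complexConj L) 3 ((StdForm.antidiagonal 3).over L))] [BorelSpace (UnitaryGroup.arch (↥(maximalRealSubfield L)) L (IsCMField.complexConj L) 3 ((StdForm.antidiagonal 3).over L))]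
  [MeasurableSpace (finAdelic (↥(maximalRealSubfield L)) L (IsCMField.complexConj L) 3 ((StdForm.antidiagonal 3).over L))] [BorelSpace (finAdelic (↥(maximalRealSubfield L)) L (IsCMField.complexConj L) 3 ((StdForm.antidiagonal 3).over L))]
  (νinf : Measure (UnitaryGroup.arch (↥(maximalRealSubfield L)) L (IsCMField.complexConj L) 3 ((StdForm.antidiagonal 3).over L))) [IsFiniteMeasureOnCompacts νinf] [νinf.IsMulLeftInvariant] [νinf.IsInvInvariant] [νinf.IsOpenPosMeasure]
  (νf : Measure (finAdelic (↥(maximalRealSubfield L)) L (IsCMField.complexConj L) 3 ((StdForm.antidiagonal 3).over L))) [IsFiniteMeasureOnCompacts νf] [νf.IsMulLeftInvariant] [νf.IsInvInvariant] [νf.IsOpenPosMeasure]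
  (κ : K →* UnitaryGroup.arch (↥(maximalRealSubfield L)) L (IsCMField.complexConj L) 3 ((StdForm.antidiagonal 3).over L)) (hκ : Continuous κ)
  (μK : Measure K) [IsFiniteMeasureOnCompacts μK] [IsProbabilityMeasure μK] [MeasurableMul K] [μK.IsMulLeftInvariant] [MeasurableInv K] [μK.IsInvInvariant]
  (χ : C_c(K, ℂ)) (e : C_c(finAdelic (↥(maximalRealSubfield L)) L (IsCMField.complexConj L) 3 ((StdForm.antidiagonal 3).over L), ℂ))
  {A M : Type*} [AddCommGroup A] [Module ℂ A] [AddCommGroup M] [Module ℂ M]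
  {Ω : Type*} {mΩ : MeasurableSpace Ω} (m : Measure Ω) {E : Type*} [NormedAddCommGroup E] [NormedSpace ℂ E] {J : Type*} [Countable J]
variable [ENNReal.HolderTriple ∞ 2 2]

/-- **(N_blk,₃) BY NAME — the `hN i b` clause of ★ F1_qs at the LINE SPACE OF RECORD `resGLine L μ U′ K′ ω χ₁ χ₂`** (★ G-DEFS: `resGBlock` = the closed `(K′,ω; χ₁,χ₂)`-block
`Sc` of the Borel datum `(χ₁, χ₂)` of `U_{L∕L⁺}(3)`, `resGAtom U′ = Sc ⊓ ker (snd ∘ U′)`, `resGLine U′ = Sc ⊓ (resGAtom U′)ᗮ`, for the THREE-SLOT block-model coordinate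
`U′ : L² →ₗ[ℂ] (A × M) × L²(Ω; E)` — top atoms × middle atoms × line — of D5′ bridge currency).  §2 at `U := snd ∘ U′`, with the two interface letters DISCHARGED by the read-backs of the
defs: `hLnP` from `resGLine ≤ resGBlock ≤ V_P` (the visible letter `hScP : resGBlock ≤ V_P` — the block's generators are `(K′,ω)`-isotypic; payer at the Σ-family: ★
`cm_blockProjector_eq_self_iff` + `isClosed_eqLocus_id`) and `hLnU` from ★ `inner_eq_zero_of_mem_resGLine` at `y := P_{Sc} x` (orthogonal projection onto the closed block, ★
`isClosed_resGBlock`) together with the visible letter `hUker : Scᗮ ≤ ker U′` («`U′ = U_SD ∘ P_{Sc}` factors through the block», by construction of the model — payer: whoever fixes `U′`),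
which gives `U′ (P_{Sc} x) = U′ x`.  Remaining visible bill: D5′'s `(κ, μK, χ; e, K′_f)`, `hPdef`, (L1) `T hT𝓐 hTP hTB`, (L2) `U′ s hs hU`, (L3) `hline`, and `hScP`, `hUker` — IDENTICAL to
the H side ★ `resH_isotypic_le_orthogonal_lines`. [cite: MoeglinWaldspurger1995, I.2.18, IV.3.12, V.3.13, VI.2] [cite: Rogawski1990, §13.9 p. 229] [cite: ReedSimonI1980, Thm. II.3] -/
theorem resG_isotypic_le_orthogonal_lines
    (𝔓 : (quasiSplit (↥(maximalRealSubfield L)) L (IsCMField.complexConj L) 3).ParabolicUnipotentData)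
    (K' : Subgroup (quasiSplit (↥(maximalRealSubfield L)) L (IsCMField.complexConj L) 3).Adelic) (ω : ↥K' →* ℂ)
    (χ₁ : HeckeCharacter L) (χ₂ : ↥(TorusDict.torus (IsCMField.complexConj L)) →ₜ* ℂˣ)
    (hχmul : ∀ k l, χ (k * l) = χ k * χ l) (hχone : χ 1 = 1) (hχinv : ∀ k, conj (χ k⁻¹) = χ k)
    (K'f : Subgroup (finAdelic (↥(maximalRealSubfield L)) L (IsCMField.complexConj L) 3 ((StdForm.antidiagonal 3).over L))) (he0 : ∀ x, x ∉ K'f → e x = 0) (he1 : ∫ x, e x ∂νf = 1)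
    (heK : ∀ k ∈ K'f, ∀ x, e (k * x) = e x) (hestar : ∀ x, mulStar (⇑e) x = e x)
    (P : (quasiSplit (↥(maximalRealSubfield L)) L (IsCMField.complexConj L) 3).L2 μ →L[ℂ] (quasiSplit (↥(maximalRealSubfield L)) L (IsCMField.complexConj L) 3).L2 μ)
    (hPdef : P = ((((quasiSplit (↥(maximalRealSubfield L)) L (IsCMField.complexConj L) 3).rightRegular μ).restrict ((archToAdelic (↥(maximalRealSubfield L)) L (IsCMField.complexConj L) 3 ((StdForm.antidiagonal 3).over L)).comp κ)).integratedOperator (((quasiSplit (↥(maximalRealSubfield L)) L (IsCMField.complexConj L) 3).isUnitary_rightRegular μ).restrict _)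
          (((quasiSplit (↥(maximalRealSubfield L)) L (IsCMField.complexConj L) 3).isStronglyContinuous_rightRegular_holds μ).restrict _ ((continuous_archToAdelic (↥(maximalRealSubfield L)) L (IsCMField.complexConj L) 3 ((StdForm.antidiagonal 3).over L)).comp hκ)) μK χ ∘L
        (((quasiSplit (↥(maximalRealSubfield L)) L (IsCMField.complexConj L) 3).rightRegular μ).restrict (finAdelicToAdelic (↥(maximalRealSubfield L)) L (IsCMField.complexConj L) 3 ((StdForm.antidiagonal 3).over L))).integratedOperator (((quasiSplit (↥(maximalRealSubfield L)) L (IsCMField.complexConj L) 3).isUnitary_rightRegular μ).restrict _) (((quasiSplit (↥(maximalRealSubfield L)) L (IsCMField.complexConj L) 3).isStronglyContinuous_rightRegular_holds μ).restrict _ (continuous_finAdelicToAdelic (↥(maximalRealSubfield L)) L (IsCMField.complexConj L) 3 ((StdForm.antidiagonal 3).over L))) νf e))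
    (T : J → (quasiSplit (↥(maximalRealSubfield L)) L (IsCMField.complexConj L) 3).L2 μ →L[ℂ] (quasiSplit (↥(maximalRealSubfield L)) L (IsCMField.complexConj L) 3).L2 μ)
    (hT𝓐 : ∀ j, T j ∈ {A' : (quasiSplit (↥(maximalRealSubfield L)) L (IsCMField.complexConj L) 3).L2 μ →L[ℂ] (quasiSplit (↥(maximalRealSubfield L)) L (IsCMField.complexConj L) 3).L2 μ | ∃ (a : C_c(UnitaryGroup.arch (↥(maximalRealSubfield L)) L (IsCMField.complexConj L) 3 ((StdForm.antidiagonal 3).over L), ℂ)) (b : C_c(finAdelic (↥(maximalRealSubfield L)) L (IsCMField.complexConj L) 3 ((StdForm.antidiagonal 3).over L), ℂ)),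
      A' = (((quasiSplit (↥(maximalRealSubfield L)) L (IsCMField.complexConj L) 3).rightRegular μ).restrict (archToAdelic (↥(maximalRealSubfield L)) L (IsCMField.complexConj L) 3 ((StdForm.antidiagonal 3).over L))).integratedOperator (((quasiSplit (↥(maximalRealSubfield L)) L (IsCMField.complexConj L) 3).isUnitary_rightRegular μ).restrict _) (((quasiSplit (↥(maximalRealSubfield L)) L (IsCMField.complexConj L) 3).isStronglyContinuous_rightRegular_holds μ).restrict _ (continuous_archToAdelic (↥(maximalRealSubfield L)) L (IsCMField.complexConj L) 3 ((StdForm.antidiagonal 3).over L))) νinf a ∘L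
          (((quasiSplit (↥(maximalRealSubfield L)) L (IsCMField.complexConj L) 3).rightRegular μ).restrict (finAdelicToAdelic (↥(maximalRealSubfield L)) L (IsCMField.complexConj L) 3 ((StdForm.antidiagonal 3).over L))).integratedOperator (((quasiSplit (↥(maximalRealSubfield L)) L (IsCMField.complexConj L) 3).isUnitary_rightRegular μ).restrict _) (((quasiSplit (↥(maximalRealSubfield L)) L (IsCMField.complexConj L) 3).isStronglyContinuous_rightRegular_holds μ).restrict _ (continuous_finAdelicToAdelic (↥(maximalRealSubfield L)) L (IsCMField.complexConj L) 3 ((StdForm.antidiagonal 3).over L))) νf b})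
    (hTP : ∀ j, Commute P (T j))
    (hTB : ∀ j, ∀ A' ∈ {A' : (quasiSplit (↥(maximalRealSubfield L)) L (IsCMField.complexConj L) 3).L2 μ →L[ℂ] (quasiSplit (↥(maximalRealSubfield L)) L (IsCMField.complexConj L) 3).L2 μ | ∃ (a : C_c(UnitaryGroup.arch (↥(maximalRealSubfield L)) L (IsCMField.complexConj L) 3 ((StdForm.antidiagonal 3).over L), ℂ)) (b : C_c(finAdelic (↥(maximalRealSubfield L)) L (IsCMField.complexConj L) 3 ((StdForm.antidiagonal 3).over L), ℂ)),
      A' = (((quasiSplit (↥(maximalRealSubfield L)) L (IsCMField.complexConj L) 3).rightRegular μ).restrict (archToAdelic (↥(maximalRealSubfield L)) L (IsCMField.complexConj L) 3 ((StdForm.antidiagonal 3).over L))).integratedOperator (((quasiSplit (↥(maximalRealSubfield L)) L (IsCMField.complexConj L) 3).isUnitary_rightRegular μ).restrict _) (((quasiSplit (↥(maximalRealSubfield L)) L (IsCMField.complexConj L) 3).isStronglyContinuous_rightRegular_holds μ).restrict _ (continuous_archToAdelic (↥(maximalRealSubfield L)) L (IsCMField.complexConj L) 3 ((StdForm.antidiagonal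 3).over L))) νinf a ∘L
          (((quasiSplit (↥(maximalRealSubfield L)) L (IsCMField.complexConj L) 3).rightRegular μ).restrict (finAdelicToAdelic (↥(maximalRealSubfield L)) L (IsCMField.complexConj L) 3 ((StdForm.antidiagonal 3).over L))).integratedOperator (((quasiSplit (↥(maximalRealSubfield L)) L (IsCMField.complexConj L) 3).isUnitary_rightRegular μ).restrict _) (((quasiSplit (↥(maximalRealSubfield L)) L (IsCMField.complexConj L) 3).isStronglyContinuous_rightRegular_holds μ).restrict _ (continuous_finAdelicToAdelic (↥(maximalRealSubfield L)) L (IsCMField.complexConj L) 3 ((StdForm.antidiagonal 3).over L))) νf b},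
      ∀ x ∈ LinearMap.eqLocus (P : (quasiSplit (↥(maximalRealSubfield L)) L (IsCMField.complexConj L) 3).L2 μ →ₗ[ℂ] (quasiSplit (↥(maximalRealSubfield L)) L (IsCMField.complexConj L) 3).L2 μ) LinearMap.id, P (A' (T j x)) = T j (P (A' x)))
    (U' : (quasiSplit (↥(maximalRealSubfield L)) L (IsCMField.complexConj L) 3).L2 μ →ₗ[ℂ] (A × M) × Lp E 2 m) (s : J → Ω → ℂ) (hs : ∀ j, MemLp (s j) ∞ m)
    (hU : ∀ j, ∀ v ∈ LinearMap.eqLocus (P : (quasiSplit (↥(maximalRealSubfield L)) L (IsCMField.complexConj L) 3).L2 μ →ₗ[ℂ] (quasiSplit (↥(maximalRealSubfield L)) L (IsCMField.complexConj L) 3).L2 μ) LinearMap.id, (U' (T j v)).2 = ((hs j).toLp (s j) • (U' v).2 : Lp E 2 m))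
    (hline : ∀ c : J → ℂ, m {x | ∀ j, s j x = c j} = 0)
    (hScP : resGBlock L μ K' ω χ₁ χ₂ ≤ LinearMap.eqLocus (P : (quasiSplit (↥(maximalRealSubfield L)) L (IsCMField.complexConj L) 3).L2 μ →ₗ[ℂ] (quasiSplit (↥(maximalRealSubfield L)) L (IsCMField.complexConj L) 3).L2 μ) LinearMap.id)
    (hUker : (resGBlock L μ K' ω χ₁ χ₂)ᗮ ≤ LinearMap.ker U') :
    ∀ W' : ClosedSubrep ((quasiSplit (↥(maximalRealSubfield L)) L (IsCMField.complexConj L) 3).rightRegular μ), W'.toContRep.IsTopIrreducible →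
      W' ≤ residualSubspace (quasiSplit (↥(maximalRealSubfield L)) L (IsCMField.complexConj L) 3) μ 𝔓 →
        W'.toSubmodule ⊓ (⨅ k : ↥K', Module.End.eigenspace ((((quasiSplit (↥(maximalRealSubfield L)) L (IsCMField.complexConj L) 3).rightRegular μ) (K'.subtype k) : (quasiSplit (↥(maximalRealSubfield L)) L (IsCMField.complexConj L) 3).L2 μ →L[ℂ] (quasiSplit (↥(maximalRealSubfield L)) L (IsCMField.complexConj L) 3).L2 μ) :
          (quasiSplit (↥(maximalRealSubfield L)) L (IsCMField.complexConj L) 3).L2 μ →ₗ[ℂ] (quasiSplit (↥(maximalRealSubfield L)) L (IsCMField.complexConj L) 3).L2 μ) (ω k)) ≤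
          (resGLine L μ U' K' ω χ₁ χ₂)ᗮ := by
  -- the closed block is complete, so it has an orthogonal projection `P_{Sc}`
  haveI : CompleteSpace (resGBlock L μ K' ω χ₁ χ₂) := (isClosed_resGBlock L μ K' ω χ₁ χ₂).completeSpace_coe
  refine resG_isotypic_le_orthogonal_of_lineModel L μ νinf νf κ hκ μK χ e m 𝔓 K' ω hχmul hχone hχinv K'f he0 he1 heK hestar P hPdef T hT𝓐 hTP hTB
    ((LinearMap.snd ℂ (A × M) (Lp E 2 m)).comp U') s hs (fun j v hv => ?_) hline (resGLine L μ U' K' ω χ₁ χ₂) (fun v hv => ?_) (fun v hv y _ hUy => ?_)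
  · -- `hU` on the line coordinate
    simpa only [LinearMap.comp_apply, LinearMap.snd_apply] using hU j v hv
  · -- `hLnP`: `Ln ≤ Sc ≤ V_P`
    exact apply_eq_of_mem_eqLocus P v (hScP (resGLine_le_resGBlock L μ U' K' ω χ₁ χ₂ hv))
  · -- `hLnU`: ★ `inner_eq_zero_of_mem_resGLine` at `y₀ := P_{Sc} y`, with `U′ y₀ = U′ y` from `hUker`
    refine inner_eq_zero_of_mem_resGLine L μ U' K' ω χ₁ χ₂ hv y
      ⟨(resGBlock L μ K' ω χ₁ χ₂).starProjection y, Submodule.starProjection_apply_mem _ y, Submodule.sub_starProjection_mem_orthogonal y, ?_⟩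
    have hker : U' (y - (resGBlock L μ K' ω χ₁ χ₂).starProjection y) = 0 :=
      LinearMap.mem_ker.1 (hUker (Submodule.sub_starProjection_mem_orthogonal y))
    have hEq : U' ((resGBlock L μ K' ω χ₁ χ₂).starProjection y) = U' y := by
      rw [map_sub, sub_eq_zero] at hker
      exact hker.symm
    rw [hEq]
    simpa only [LinearMap.comp_apply, LinearMap.snd_apply] using hUy


end ByName

end Summit.HodgeConjecture.HodgeConjecture.R90.S8

end
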